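import Literature.NumberTheory.DiophantineGeometry.ShuteFourSquarefulMoment

/-!
# Shute (2021), §3: reduction of the fourth-moment bound to the generic (distinct-`|yᵢ|`) count

Fourth companion to `ShuteFourSquareful.lean` (named fact `Shute2021_prop32` = Shute's Prop. 3.2),
after `ShuteFourSquarefulHolder.lean`, `ShuteFourSquarefulCounting.lean` and
`ShuteFourSquarefulMoment.lean`.

Recall `N(X, Y) = Shute2021.fourthMoment X Y = #{x₁²y₁³ + x₂²y₂³ = x₃²y₃³ + x₄²y₄³ :
0 < |xᵢ| ≤ X, 0 < |yᵢ| ≤ Y, yᵢ square-free}` and that `Shute2021_prop32` is EQUIVALENT to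
`N(X, Y) ≪_ε X^{2+ε} Y^{8/3+ε}` (`Shute2021.Shute2021_prop32_iff_fourthMoment_le`), while the
library proves `N(X, Y) ≪_ε X^{2+ε} Y^{3+ε}` (`Shute2021.fourthMoment_le_three`).

## What is proved here

Let `N_gen(X, Y) = Shute2021.genericMoment X Y` be the number of those solutions whose four
square-free parameters have PAIRWISE DISTINCT absolute values `|y₁|, |y₂|, |y₃|, |y₄|` (for such
`𝐲` the quadric `Σ ±|yᵢ|³xᵢ² = 0` has no vanishing proper subsum, i.e. no "trivial" solutions at
all). We prove, unconditionally and by elementary means,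

* `Shute2021.fourthMoment_le_genericMoment_add_mul_monoCount` (exact form):
  `N(X, Y) ≤ N_gen(X, Y) + 12 · K(X, Y)`, where `K = Shute2021.monoCount X Y` is the monochromatic
  count `#{y₁³(x₁² − x₁'²) = x₃²y₃³ − x₃'²y₃'³}` of `ShuteFourSquarefulCounting.lean`;
* `Shute2021.monoCount_le`: `K(X, Y) ≤ C_ε X^{2+ε} Y^{2+ε}` (the bound implicit in the proof of
  `fourthMoment_le_three`), hence
  `Shute2021.fourthMoment_le_genericMoment_add`: `N(X, Y) ≤ N_gen(X, Y) + C_ε X^{2+ε} Y^{2+ε}`;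
* the resulting criteria: `Shute2021.Shute2021_prop32_of_genericMoment_le`
  (`N_gen ≪_ε X^{2+ε}Y^{8/3+ε} ⟹ Shute2021_prop32`) and, for the additive energy of the squareful
  shape `S(X, Y) = {x²y³ : 1 ≤ x ≤ X, 1 ≤ y ≤ Y, y square-free}` consumed by route
  `ABC/ExceptionalSetEnergy`, `Shute2021.addEnergy_squarefulShape_le_genericMoment_add`
  (`E[S, S] ≤ N_gen(X, Y) + C_ε (XY)^ε X²Y²`) and
  `Shute2021.addEnergy_squarefulShape_le_two_of_genericMoment_le`
  (`N_gen ≪_ε (XY)^ε X²Y² ⟹ E[S, S] ≪_ε (XY)^ε X²Y²`, the shape of route item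
  `SquarefulShapeEnergy`).

So the printed exponent `8/3` of Prop. 3.2, and the conjectural exponent `2`, are each equivalent
(up to the proved `X^{2+ε}Y^{2+ε}`) to the corresponding bound for the generic count alone;
heuristically `N_gen(X, Y) ≍ X²Y` for `X² ≥ Y³` (each of the `≍ Y⁴` quadrics
`y₁³x₁² + y₂³x₂² = y₃³x₃² + y₄³x₄²` carries about `X⁴/(X²Y³)` points of height `≤ X`).

## The argument (Cauchy–Schwarz on a signed colour)

Write a solution as `((a, a'), (b, b'))` with `val a − val a' = val b − val b'`, `val (x, y) = x²y³`
(`Shute2021.fourthMoment_eq_diffEnergy`). If it is not generic, then `yᵢ = s·yⱼ` for one of the six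
pairs of positions and a sign `s = ±1`. Re-pair the four points so that the two coincident points
sit on opposite sides of the equation (for the pairs `(a, a')`, `(b, b')` this is
`val a − val b = val a' − val b'`); the solutions with `yᵢ = s·yⱼ` then form a collision count
`coll(P², P²; (F, colour), (G, s·colour))` between PAIR-valued maps, and Cauchy–Schwarz
(`Shute2021.coll_sq_le`) bounds its square by the product of the two self-collision counts with
EQUAL signed colour, each of which is `K(X, Y)` after reindexing (`Shute2021.coll_psiS`,
`Shute2021.coll_psi₂`, `Shute2021.coll_psi₂S`): with equal `y`-coordinates,
`val p − val p' = y³(x² − x'²)`, so only differences of two squares occur and the divisor-bound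
count of `ShuteFourSquarefulCounting.lean` applies. Hence each of the `12` pattern counts is
`≤ K(X, Y)`.

## Status of Prop. 3.2 (why this file stops here)

The source (A. Shute, arXiv:2104.06966, §3; reproduced verbatim as Prop. 6.3.2, §6.3, pp. 79–84 of
A. L. Shute, *Existence and density problems in Diophantine geometry*, PhD thesis, ISTA 2022,
doi:10.15479/at:ista:12072) bounds `N(X, Y) ≤ 4XY·L(X, Y)` by two Cauchy–Schwarz steps and then
estimates `L` under the exclusion `x₁ ≠ ±x₂` made BEFORE Cauchy–Schwarz ("Note `u ≠ 0` by the
assumption `x₁ ≠ ±x₂`"), which does not survive it: the unrestricted `L(X, Y)` contains the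
`≍ X²Y²` tuples with `y₁ = y₂`, `x₁ = ±x₂`, so the printed chain only yields `N(X, Y) ≪ X³Y³`.
No other proof of the exponent `8/3` is known to us; by the present file it amounts to
`N_gen(X, Y) ≪_ε X^{2+ε} Y^{8/3+ε}`, for which fibring over `𝐲` with divisor bounds on the conics
gives only `X^{2+ε}Y⁴`, and the inherited bound is `X^{2+ε}Y^{3+ε}`.

## References

* A. Shute, *Sums of four squareful numbers*, arXiv:2104.06966 (2021), §3, Prop. 3.2 and its
  proof. [Shute2021]
* A. L. Shute, *Existence and density problems in Diophantine geometry: From norm forms to Campana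
  points*, PhD thesis, Institute of Science and Technology Austria (2022),
  doi:10.15479/at:ista:12072, §6.3, Prop. 6.3.2 (= Prop. 3.2, same proof).
-/

noncomputable section

open Finset

namespace Literature.NumberTheory.DiophantineGeometry

namespace Shute2021

/-! ### Cauchy–Schwarz with a signed colour: every coincidence pattern is `≤ K(X, Y)` -/

section Patterns

variable {X Y : ℕ}

/-- If both self-collision counts are `≤ K`, so is the mixed collision count (Cauchy–Schwarz
`coll(A, B)² ≤ coll(A, A) coll(B, B)`). [folklore] -/
theorem coll_le_of_self_le {α β M : Type*} [DecidableEq M] {A : Finset α} {B : Finset β}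
    {f : α → M} {g : β → M} {K : ℕ} (hA : coll A A f f ≤ K) (hB : coll B B g g ≤ K) :
    coll A B f g ≤ K := by
  have h : coll A B f g ^ 2 ≤ K ^ 2 :=
    (coll_sq_le A B f g).trans (by rw [sq]; exact Nat.mul_le_mul hA hB)
  exact (pow_le_pow_iff_left₀ (Nat.zero_le _) (Nat.zero_le _) two_ne_zero).1 h

/-- The pair map `(p, p') ↦ (val p − val p', s·y)` (value difference, scaled colour of the FIRST
point). For `s = 1` this is `Shute2021.psi`. [folklore] -/
def psiS (s : ℤ) (q : (ℤ × ℤ) × (ℤ × ℤ)) : ℤ × ℤ := (val q.1 - val q.2, s * q.1.2)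

/-- The pair map `(p, p') ↦ (val p − val p', y')` (value difference, colour of the SECOND point).
[folklore] -/
def psi₂ (q : (ℤ × ℤ) × (ℤ × ℤ)) : ℤ × ℤ := (val q.1 - val q.2, q.2.2)

/-- The pair map `(p, p') ↦ (val p − val p', s·y')`. [folklore] -/
def psi₂S (s : ℤ) (q : (ℤ × ℤ) × (ℤ × ℤ)) : ℤ × ℤ := (val q.1 - val q.2, s * q.2.2)

/-- Scaling the colour by `s ≠ 0` does not change a self-collision count: with the first colour,
it is the monochromatic count `K(X, Y)`. [folklore] -/
theorem coll_psiS {s : ℤ} (hs : s ≠ 0) :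
    coll (pts X Y ×ˢ pts X Y) (pts X Y ×ˢ pts X Y) (psiS s) (psiS s) = monoCount X Y := by
  unfold monoCount coll
  congr 1
  refine filter_congr fun r _ => ?_
  simp only [psiS, psi, Prod.mk.injEq]
  exact and_congr_right fun _ => ⟨fun h => mul_left_cancel₀ hs h, fun h => by rw [h]⟩

/-- With the second colour the self-collision count is again `K(X, Y)` (swap the two points of
both pairs; the value differences change sign on both sides). [folklore] -/
theorem coll_psi₂ :
    coll (pts X Y ×ˢ pts X Y) (pts X Y ×ˢ pts X Y) psi₂ psi₂ = monoCount X Y := by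
  unfold monoCount coll
  -- swap the two points of both pairs (an involution)
  refine card_nbij' (fun r => ((r.1.2, r.1.1), (r.2.2, r.2.1)))
    (fun r => ((r.1.2, r.1.1), (r.2.2, r.2.1))) ?_ ?_ (fun r _ => rfl) (fun r _ => rfl)
  · intro r hr
    rw [mem_coe, mem_filter, mem_product, mem_product, mem_product] at hr ⊢
    obtain ⟨⟨⟨h1, h2⟩, h3, h4⟩, h⟩ := hr
    simp only [psi₂, psi, Prod.mk.injEq] at h ⊢
    exact ⟨⟨⟨h2, h1⟩, h4, h3⟩, by linear_combination -h.1, h.2⟩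
  · intro r hr
    rw [mem_coe, mem_filter, mem_product, mem_product, mem_product] at hr ⊢
    obtain ⟨⟨⟨h1, h2⟩, h3, h4⟩, h⟩ := hr
    simp only [psi₂, psi, Prod.mk.injEq] at h ⊢
    exact ⟨⟨⟨h2, h1⟩, h4, h3⟩, by linear_combination -h.1, h.2⟩

/-- Scaled second colour: still `K(X, Y)`. [folklore] -/
theorem coll_psi₂S {s : ℤ} (hs : s ≠ 0) :
    coll (pts X Y ×ˢ pts X Y) (pts X Y ×ˢ pts X Y) (psi₂S s) (psi₂S s) = monoCount X Y := by
  rw [← coll_psi₂ (X := X) (Y := Y)]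
  unfold coll
  congr 1
  refine filter_congr fun r _ => ?_
  simp only [psi₂S, psi₂, Prod.mk.injEq]
  exact and_congr_right fun _ => ⟨fun h => mul_left_cancel₀ hs h, fun h => by rw [h]⟩

/-- Pattern `y(a) = s·y(b)` for solutions `((a, a'), (b, b'))` of `val a − val a' = val b − val b'`:
at most `K(X, Y)` of them (`s ≠ 0`). [folklore] -/
theorem card_pattern₁₃_le {s : ℤ} (hs : s ≠ 0) :
    #{q ∈ (pts X Y ×ˢ pts X Y) ×ˢ (pts X Y ×ˢ pts X Y) |
        val q.1.1 - val q.1.2 = val q.2.1 - val q.2.2 ∧ q.1.1.2 = s * q.2.1.2} ≤ monoCount X Y := by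
  have h : #{q ∈ (pts X Y ×ˢ pts X Y) ×ˢ (pts X Y ×ˢ pts X Y) |
      val q.1.1 - val q.1.2 = val q.2.1 - val q.2.2 ∧ q.1.1.2 = s * q.2.1.2} =
      coll (pts X Y ×ˢ pts X Y) (pts X Y ×ˢ pts X Y) psi (psiS s) := by
    unfold coll
    congr 1
    refine filter_congr fun q _ => ?_
    simp only [psi, psiS, Prod.mk.injEq]
  rw [h]
  exact coll_le_of_self_le (le_of_eq rfl) (le_of_eq (coll_psiS hs))

/-- Pattern `y(a') = s·y(b')`: at most `K(X, Y)` solutions. [folklore] -/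
theorem card_pattern₂₄_le {s : ℤ} (hs : s ≠ 0) :
    #{q ∈ (pts X Y ×ˢ pts X Y) ×ˢ (pts X Y ×ˢ pts X Y) |
        val q.1.1 - val q.1.2 = val q.2.1 - val q.2.2 ∧ q.1.2.2 = s * q.2.2.2} ≤ monoCount X Y := by
  have h : #{q ∈ (pts X Y ×ˢ pts X Y) ×ˢ (pts X Y ×ˢ pts X Y) |
      val q.1.1 - val q.1.2 = val q.2.1 - val q.2.2 ∧ q.1.2.2 = s * q.2.2.2} =
      coll (pts X Y ×ˢ pts X Y) (pts X Y ×ˢ pts X Y) psi₂ (psi₂S s) := by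
    unfold coll
    congr 1
    refine filter_congr fun q _ => ?_
    simp only [psi₂, psi₂S, Prod.mk.injEq]
  rw [h]
  exact coll_le_of_self_le (le_of_eq coll_psi₂) (le_of_eq (coll_psi₂S hs))

/-- Pattern `y(a) = s·y(b')`: at most `K(X, Y)` solutions. [folklore] -/
theorem card_pattern₁₄_le {s : ℤ} (hs : s ≠ 0) :
    #{q ∈ (pts X Y ×ˢ pts X Y) ×ˢ (pts X Y ×ˢ pts X Y) |
        val q.1.1 - val q.1.2 = val q.2.1 - val q.2.2 ∧ q.1.1.2 = s * q.2.2.2} ≤ monoCount X Y := by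
  have h : #{q ∈ (pts X Y ×ˢ pts X Y) ×ˢ (pts X Y ×ˢ pts X Y) |
      val q.1.1 - val q.1.2 = val q.2.1 - val q.2.2 ∧ q.1.1.2 = s * q.2.2.2} =
      coll (pts X Y ×ˢ pts X Y) (pts X Y ×ˢ pts X Y) psi (psi₂S s) := by
    unfold coll
    congr 1
    refine filter_congr fun q _ => ?_
    simp only [psi, psi₂S, Prod.mk.injEq]
  rw [h]
  exact coll_le_of_self_le (le_of_eq rfl) (le_of_eq (coll_psi₂S hs))

/-- Pattern `y(a') = s·y(b)`: at most `K(X, Y)` solutions. [folklore] -/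
theorem card_pattern₂₃_le {s : ℤ} (hs : s ≠ 0) :
    #{q ∈ (pts X Y ×ˢ pts X Y) ×ˢ (pts X Y ×ˢ pts X Y) |
        val q.1.1 - val q.1.2 = val q.2.1 - val q.2.2 ∧ q.1.2.2 = s * q.2.1.2} ≤ monoCount X Y := by
  have h : #{q ∈ (pts X Y ×ˢ pts X Y) ×ˢ (pts X Y ×ˢ pts X Y) |
      val q.1.1 - val q.1.2 = val q.2.1 - val q.2.2 ∧ q.1.2.2 = s * q.2.1.2} =
      coll (pts X Y ×ˢ pts X Y) (pts X Y ×ˢ pts X Y) psi₂ (psiS s) := by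
    unfold coll
    congr 1
    refine filter_congr fun q _ => ?_
    simp only [psi₂, psiS, Prod.mk.injEq]
  rw [h]
  exact coll_le_of_self_le (le_of_eq coll_psi₂) (le_of_eq (coll_psiS hs))

/-- Pattern `y(a) = s·y(a')` (both points on the same side): re-pair as
`val a − val b = val a' − val b'`; at most `K(X, Y)` solutions. [folklore] -/
theorem card_pattern₁₂_le {s : ℤ} (hs : s ≠ 0) :
    #{q ∈ (pts X Y ×ˢ pts X Y) ×ˢ (pts X Y ×ˢ pts X Y) |
        val q.1.1 - val q.1.2 = val q.2.1 - val q.2.2 ∧ q.1.1.2 = s * q.1.2.2} ≤ monoCount X Y := by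
  have h : #{q ∈ (pts X Y ×ˢ pts X Y) ×ˢ (pts X Y ×ˢ pts X Y) |
      val q.1.1 - val q.1.2 = val q.2.1 - val q.2.2 ∧ q.1.1.2 = s * q.1.2.2} =
      coll (pts X Y ×ˢ pts X Y) (pts X Y ×ˢ pts X Y) psi (psiS s) := by
    unfold coll
    refine card_equiv (Equiv.prodProdProdComm _ _ _ _) fun q => ?_
    simp only [mem_filter, mem_product, Equiv.prodProdProdComm_apply, psi, psiS, Prod.mk.injEq]
    constructor
    · rintro ⟨⟨⟨h1, h2⟩, h3, h4⟩, hv, hy⟩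
      exact ⟨⟨⟨h1, h3⟩, h2, h4⟩, by linear_combination hv, hy⟩
    · rintro ⟨⟨⟨h1, h3⟩, h2, h4⟩, hv, hy⟩
      exact ⟨⟨⟨h1, h2⟩, h3, h4⟩, by linear_combination hv, hy⟩
  rw [h]
  exact coll_le_of_self_le (le_of_eq rfl) (le_of_eq (coll_psiS hs))

/-- Pattern `y(b) = s·y(b')`: same re-pairing, second colours; at most `K(X, Y)` solutions.
[folklore] -/
theorem card_pattern₃₄_le {s : ℤ} (hs : s ≠ 0) :
    #{q ∈ (pts X Y ×ˢ pts X Y) ×ˢ (pts X Y ×ˢ pts X Y) |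
        val q.1.1 - val q.1.2 = val q.2.1 - val q.2.2 ∧ q.2.1.2 = s * q.2.2.2} ≤ monoCount X Y := by
  have h : #{q ∈ (pts X Y ×ˢ pts X Y) ×ˢ (pts X Y ×ˢ pts X Y) |
      val q.1.1 - val q.1.2 = val q.2.1 - val q.2.2 ∧ q.2.1.2 = s * q.2.2.2} =
      coll (pts X Y ×ˢ pts X Y) (pts X Y ×ˢ pts X Y) psi₂ (psi₂S s) := by
    unfold coll
    refine card_equiv (Equiv.prodProdProdComm _ _ _ _) fun q => ?_
    simp only [mem_filter, mem_product, Equiv.prodProdProdComm_apply, psi₂, psi₂S, Prod.mk.injEq]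
    constructor
    · rintro ⟨⟨⟨h1, h2⟩, h3, h4⟩, hv, hy⟩
      exact ⟨⟨⟨h1, h3⟩, h2, h4⟩, by linear_combination hv, hy⟩
    · rintro ⟨⟨⟨h1, h3⟩, h2, h4⟩, hv, hy⟩
      exact ⟨⟨⟨h1, h2⟩, h3, h4⟩, by linear_combination hv, hy⟩
  rw [h]
  exact coll_le_of_self_le (le_of_eq coll_psi₂) (le_of_eq (coll_psi₂S hs))

end Patterns

/-! ### The generic count and the decomposition `N ≤ N_gen + 12 K` -/

section Generic

variable {X Y : ℕ}

/-- **The generic fourth moment** `N_gen(X, Y)`: the solutions counted by `Shute2021.fourthMoment`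
(`x₀²y₀³ + x₁²y₁³ = x₂²y₂³ + x₃²y₃³`, `0 < |xᵢ| ≤ X`, `0 < |yᵢ| ≤ Y`, `yᵢ` square-free) whose
square-free parameters have pairwise distinct absolute values `|y₀|, |y₁|, |y₂|, |y₃|`.
[folklore] -/
def genericMoment (X Y : ℕ) : ℕ :=
  #{p ∈ box (fun _ => X) ×ˢ box (fun _ => Y) |
      (∀ i, p.1 i ≠ 0 ∧ p.2 i ≠ 0 ∧ Squarefree (p.2 i).natAbs) ∧
        p.1 0 ^ 2 * p.2 0 ^ 3 + p.1 1 ^ 2 * p.2 1 ^ 3 =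
          p.1 2 ^ 2 * p.2 2 ^ 3 + p.1 3 ^ 2 * p.2 3 ^ 3 ∧
        (|p.2 0| ≠ |p.2 1| ∧ |p.2 0| ≠ |p.2 2| ∧ |p.2 0| ≠ |p.2 3| ∧
          |p.2 1| ≠ |p.2 2| ∧ |p.2 1| ≠ |p.2 3| ∧ |p.2 2| ≠ |p.2 3|)}

/-- Genericity of a quadruple of points `((a, a'), (b, b'))`: the four `|y|` are pairwise distinct.
[folklore] -/
def Generic (q : ((ℤ × ℤ) × (ℤ × ℤ)) × ((ℤ × ℤ) × (ℤ × ℤ))) : Prop :=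
  |q.1.1.2| ≠ |q.1.2.2| ∧ |q.1.1.2| ≠ |q.2.1.2| ∧ |q.1.1.2| ≠ |q.2.2.2| ∧
    |q.1.2.2| ≠ |q.2.1.2| ∧ |q.1.2.2| ≠ |q.2.2.2| ∧ |q.2.1.2| ≠ |q.2.2.2|

/-- Genericity is decidable (six integer disequalities). [folklore] -/
instance : DecidablePred Generic := fun q => by
  unfold Generic
  infer_instance

/-- The generic count in the difference-energy indexing of `Shute2021.fourthMoment_eq_diffEnergy`.
[folklore] -/
def genericDiffEnergy (X Y : ℕ) : ℕ :=
  #{q ∈ (pts X Y ×ˢ pts X Y) ×ˢ (pts X Y ×ˢ pts X Y) |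
      val q.1.1 - val q.1.2 = val q.2.1 - val q.2.2 ∧ Generic q}

/-- `N_gen(X, Y)` in the difference-energy indexing (points in the order `(0, 2), (3, 1)`, as in
`fourthMoment_eq_diffEnergy`). [folklore] -/
theorem genericMoment_eq_genericDiffEnergy (X Y : ℕ) :
    genericMoment X Y = genericDiffEnergy X Y := by
  unfold genericMoment genericDiffEnergy
  refine card_nbij' (fun p => (((p.1 0, p.2 0), (p.1 2, p.2 2)), ((p.1 3, p.2 3), (p.1 1, p.2 1))))
    (fun q => (![q.1.1.1, q.2.2.1, q.1.2.1, q.2.1.1], ![q.1.1.2, q.2.2.2, q.1.2.2, q.2.1.2]))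
    ?_ ?_ ?_ ?_
  · intro p hp
    rw [mem_coe, mem_filter] at hp ⊢
    obtain ⟨hmem, hside, hsum, h01, h02, h03, h12, h13, h23⟩ := hp
    have h := (side_iff (X := fun _ => X) (Y := fun _ => Y) p).1 ⟨hmem, hside⟩
    refine ⟨?_, ?_, h02, h03, h01, h23, h12.symm, h13.symm⟩
    · rw [mem_product, mem_product, mem_product]
      exact ⟨⟨h.1.1, h.2.1⟩, h.2.2, h.1.2⟩
    · change p.1 0 ^ 2 * p.2 0 ^ 3 - p.1 2 ^ 2 * p.2 2 ^ 3 = p.1 3 ^ 2 * p.2 3 ^ 3 - p.1 1 ^ 2 * p.2 1 ^ 3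
      linear_combination hsum
  · intro q hq
    rw [mem_coe, mem_filter] at hq ⊢
    obtain ⟨hmem, hsum, g1, g2, g3, g4, g5, g6⟩ := hq
    rw [mem_product, mem_product, mem_product] at hmem
    have hside := (side_iff (X := fun _ => X) (Y := fun _ => Y)
      (![q.1.1.1, q.2.2.1, q.1.2.1, q.2.1.1], ![q.1.1.2, q.2.2.2, q.1.2.2, q.2.1.2])).2
      ⟨⟨hmem.1.1, hmem.2.2⟩, hmem.1.2, hmem.2.1⟩
    refine ⟨hside.1, hside.2, ?_, ?_⟩
    · change q.1.1.1 ^ 2 * q.1.1.2 ^ 3 - q.1.2.1 ^ 2 * q.1.2.2 ^ 3 =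
        q.2.1.1 ^ 2 * q.2.1.2 ^ 3 - q.2.2.1 ^ 2 * q.2.2.2 ^ 3 at hsum
      change q.1.1.1 ^ 2 * q.1.1.2 ^ 3 + q.2.2.1 ^ 2 * q.2.2.2 ^ 3 =
        q.1.2.1 ^ 2 * q.1.2.2 ^ 3 + q.2.1.1 ^ 2 * q.2.1.2 ^ 3
      linear_combination hsum
    · change |q.1.1.2| ≠ |q.2.2.2| ∧ |q.1.1.2| ≠ |q.1.2.2| ∧ |q.1.1.2| ≠ |q.2.1.2| ∧
        |q.2.2.2| ≠ |q.1.2.2| ∧ |q.2.2.2| ≠ |q.2.1.2| ∧ |q.1.2.2| ≠ |q.2.1.2|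
      exact ⟨g3, g1, g2, g5.symm, g6.symm, g4⟩
  · intro p _
    exact Prod.ext (funext fun i => by fin_cases i <;> rfl) (funext fun i => by fin_cases i <;> rfl)
  · intro q _
    rfl

/-- The generic count is part of the fourth moment. [folklore] -/
theorem genericMoment_le_fourthMoment (X Y : ℕ) : genericMoment X Y ≤ fourthMoment X Y := by
  unfold genericMoment fourthMoment
  exact card_le_card (fun p hp => by
    rw [mem_filter] at hp ⊢
    exact ⟨hp.1, hp.2.1, hp.2.2.1⟩)

/-- Solutions with `|y| = |y'|` at two given positions number at most `2K`, given the pattern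
bounds `≤ K` for `y = 1·y'` and `y = (−1)·y'`. [folklore] -/
theorem card_abs_pattern_le {Q : Finset (((ℤ × ℤ) × (ℤ × ℤ)) × ((ℤ × ℤ) × (ℤ × ℤ)))}
    {E : ((ℤ × ℤ) × (ℤ × ℤ)) × ((ℤ × ℤ) × (ℤ × ℤ)) → Prop} [DecidablePred E] {K : ℕ}
    (c d : ((ℤ × ℤ) × (ℤ × ℤ)) × ((ℤ × ℤ) × (ℤ × ℤ)) → ℤ)
    (h : ∀ s : ℤ, s ≠ 0 → #{q ∈ Q | E q ∧ c q = s * d q} ≤ K) :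
    #{q ∈ Q | E q ∧ |c q| = |d q|} ≤ 2 * K := by
  have h1 := h 1 one_ne_zero
  have h2 := h (-1) (by norm_num)
  calc _ ≤ #({q ∈ Q | E q ∧ c q = 1 * d q} ∪ {q ∈ Q | E q ∧ c q = (-1) * d q}) := by
        refine card_le_card fun q hq => ?_
        rw [mem_filter] at hq
        rw [mem_union, mem_filter, mem_filter]
        rcases abs_eq_abs.1 hq.2.2 with e | e
        · exact Or.inl ⟨hq.1, hq.2.1, by rw [e, one_mul]⟩
        · exact Or.inr ⟨hq.1, hq.2.1, by rw [e, neg_one_mul]⟩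
    _ ≤ _ := (card_union_le _ _).trans (by omega)

/-- Abstract form of the decomposition: if each of the six coincidence patterns `|yᵢ| = |yⱼ|`
carries at most `2K` solutions, then all solutions are generic up to `12K`. [folklore] -/
theorem card_filter_le_generic_add {Q : Finset (((ℤ × ℤ) × (ℤ × ℤ)) × ((ℤ × ℤ) × (ℤ × ℤ)))}
    {E : ((ℤ × ℤ) × (ℤ × ℤ)) × ((ℤ × ℤ) × (ℤ × ℤ)) → Prop} [DecidablePred E] {K : ℕ}
    (h12 : #{q ∈ Q | E q ∧ |q.1.1.2| = |q.1.2.2|} ≤ 2 * K)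
    (h13 : #{q ∈ Q | E q ∧ |q.1.1.2| = |q.2.1.2|} ≤ 2 * K)
    (h14 : #{q ∈ Q | E q ∧ |q.1.1.2| = |q.2.2.2|} ≤ 2 * K)
    (h23 : #{q ∈ Q | E q ∧ |q.1.2.2| = |q.2.1.2|} ≤ 2 * K)
    (h24 : #{q ∈ Q | E q ∧ |q.1.2.2| = |q.2.2.2|} ≤ 2 * K)
    (h34 : #{q ∈ Q | E q ∧ |q.2.1.2| = |q.2.2.2|} ≤ 2 * K) :
    #{q ∈ Q | E q} ≤ #{q ∈ Q | E q ∧ Generic q} + 12 * K := by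
  rw [← card_filter_add_card_filter_not (s := {q ∈ Q | E q}) Generic, filter_filter,
    filter_filter]
  have hsub : {q ∈ Q | E q ∧ ¬ Generic q} ⊆
      {q ∈ Q | E q ∧ |q.1.1.2| = |q.1.2.2|} ∪ {q ∈ Q | E q ∧ |q.1.1.2| = |q.2.1.2|} ∪
        {q ∈ Q | E q ∧ |q.1.1.2| = |q.2.2.2|} ∪ {q ∈ Q | E q ∧ |q.1.2.2| = |q.2.1.2|} ∪
        {q ∈ Q | E q ∧ |q.1.2.2| = |q.2.2.2|} ∪ {q ∈ Q | E q ∧ |q.2.1.2| = |q.2.2.2|} := by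
    intro q hq
    rw [mem_filter] at hq
    obtain ⟨hqQ, hqE, hng⟩ := hq
    simp only [Generic, not_and_or, not_not] at hng
    simp only [mem_union, mem_filter]
    rcases hng with e | e | e | e | e | e
    · exact Or.inl (Or.inl (Or.inl (Or.inl (Or.inl ⟨hqQ, hqE, e⟩))))
    · exact Or.inl (Or.inl (Or.inl (Or.inl (Or.inr ⟨hqQ, hqE, e⟩))))
    · exact Or.inl (Or.inl (Or.inl (Or.inr ⟨hqQ, hqE, e⟩)))
    · exact Or.inl (Or.inl (Or.inr ⟨hqQ, hqE, e⟩))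
    · exact Or.inl (Or.inr ⟨hqQ, hqE, e⟩)
    · exact Or.inr ⟨hqQ, hqE, e⟩
  have hunion := card_le_card hsub
  have u1 := card_union_le {q ∈ Q | E q ∧ |q.1.1.2| = |q.1.2.2|}
    {q ∈ Q | E q ∧ |q.1.1.2| = |q.2.1.2|}
  have u2 := card_union_le
    ({q ∈ Q | E q ∧ |q.1.1.2| = |q.1.2.2|} ∪ {q ∈ Q | E q ∧ |q.1.1.2| = |q.2.1.2|})
    {q ∈ Q | E q ∧ |q.1.1.2| = |q.2.2.2|}
  have u3 := card_union_le
    ({q ∈ Q | E q ∧ |q.1.1.2| = |q.1.2.2|} ∪ {q ∈ Q | E q ∧ |q.1.1.2| = |q.2.1.2|} ∪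
      {q ∈ Q | E q ∧ |q.1.1.2| = |q.2.2.2|})
    {q ∈ Q | E q ∧ |q.1.2.2| = |q.2.1.2|}
  have u4 := card_union_le
    ({q ∈ Q | E q ∧ |q.1.1.2| = |q.1.2.2|} ∪ {q ∈ Q | E q ∧ |q.1.1.2| = |q.2.1.2|} ∪
      {q ∈ Q | E q ∧ |q.1.1.2| = |q.2.2.2|} ∪ {q ∈ Q | E q ∧ |q.1.2.2| = |q.2.1.2|})
    {q ∈ Q | E q ∧ |q.1.2.2| = |q.2.2.2|}
  have u5 := card_union_le
    ({q ∈ Q | E q ∧ |q.1.1.2| = |q.1.2.2|} ∪ {q ∈ Q | E q ∧ |q.1.1.2| = |q.2.1.2|} ∪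
      {q ∈ Q | E q ∧ |q.1.1.2| = |q.2.2.2|} ∪ {q ∈ Q | E q ∧ |q.1.2.2| = |q.2.1.2|} ∪
      {q ∈ Q | E q ∧ |q.1.2.2| = |q.2.2.2|})
    {q ∈ Q | E q ∧ |q.2.1.2| = |q.2.2.2|}
  omega

/-- **The decomposition, exact form (difference-energy indexing)**:
`E ≤ E_gen + 12 K(X, Y)`. [folklore] -/
theorem diffEnergy_le_genericDiffEnergy_add (X Y : ℕ) :
    diffEnergy val (pts X Y) ≤ genericDiffEnergy X Y + 12 * monoCount X Y := by
  unfold diffEnergy coll genericDiffEnergy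
  exact card_filter_le_generic_add
    (E := fun q => val q.1.1 - val q.1.2 = val q.2.1 - val q.2.2)
    (card_abs_pattern_le (fun q => q.1.1.2) (fun q => q.1.2.2) fun s hs => card_pattern₁₂_le hs)
    (card_abs_pattern_le (fun q => q.1.1.2) (fun q => q.2.1.2) fun s hs => card_pattern₁₃_le hs)
    (card_abs_pattern_le (fun q => q.1.1.2) (fun q => q.2.2.2) fun s hs => card_pattern₁₄_le hs)
    (card_abs_pattern_le (fun q => q.1.2.2) (fun q => q.2.1.2) fun s hs => card_pattern₂₃_le hs)
    (card_abs_pattern_le (fun q => q.1.2.2) (fun q => q.2.2.2) fun s hs => card_pattern₂₄_le hs)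
    (card_abs_pattern_le (fun q => q.2.1.2) (fun q => q.2.2.2) fun s hs => card_pattern₃₄_le hs)

/-- **The decomposition, exact form**: `N(X, Y) ≤ N_gen(X, Y) + 12 · K(X, Y)`; every solution with
a coincidence `|yᵢ| = |yⱼ|` is absorbed by the monochromatic count. [folklore] -/
theorem fourthMoment_le_genericMoment_add_mul_monoCount (X Y : ℕ) :
    fourthMoment X Y ≤ genericMoment X Y + 12 * monoCount X Y := by
  rw [fourthMoment_eq_diffEnergy, genericMoment_eq_genericDiffEnergy]
  exact diffEnergy_le_genericDiffEnergy_add X Y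

end Generic

/-! ### Real bounds: `K ≪ X^{2+ε}Y^{2+ε}`, hence `N ≤ N_gen + C_ε X^{2+ε}Y^{2+ε}` -/

section RealBound

/-- Exponent bookkeeping: for `X, Y ≥ 1` and `ε > 0`,
`X² Y² (2X²Y³)^{ε/3} ≤ 2^{ε/3} X^{2+ε} Y^{2+ε}`. [folklore] -/
theorem sq_sq_mul_rpow_le {X Y ε : ℝ} (hX : 1 ≤ X) (hY : 1 ≤ Y) (hε : 0 < ε) :
    X ^ 2 * Y ^ 2 * (2 * X ^ 2 * Y ^ 3) ^ (ε / 3) ≤ 2 ^ (ε / 3) * X ^ (2 + ε) * Y ^ (2 + ε) := by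
  have hX0 : 0 < X := by linarith
  have hY0 : 0 < Y := by linarith
  have e1 : (2 * X ^ 2 * Y ^ 3) ^ (ε / 3) = 2 ^ (ε / 3) * (X ^ 2) ^ (ε / 3) * (Y ^ 3) ^ (ε / 3) := by
    rw [Real.mul_rpow (by positivity) (by positivity), Real.mul_rpow (by positivity) (by positivity)]
  have e2 : (X ^ 2) ^ (ε / 3) ≤ X ^ ε := by
    rw [← Real.rpow_two, ← Real.rpow_mul hX0.le]
    exact Real.rpow_le_rpow_of_exponent_le hX (by linarith)
  have e3 : (Y ^ 3) ^ (ε / 3) = Y ^ ε := by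
    rw [show Y ^ 3 = Y ^ ((3 : ℕ) : ℝ) from (Real.rpow_natCast Y 3).symm, ← Real.rpow_mul hY0.le]
    congr 1
    push_cast
    ring
  have e4 : X ^ (2 + ε) = X ^ 2 * X ^ ε := by
    rw [Real.rpow_add hX0, Real.rpow_two]
  have e5 : Y ^ (2 + ε) = Y ^ 2 * Y ^ ε := by
    rw [Real.rpow_add hY0, Real.rpow_two]
  rw [e1, e3, e4, e5]
  have : 0 ≤ 2 ^ (ε / 3) * Y ^ 2 * Y ^ ε * X ^ 2 := by positivity
  calc X ^ 2 * Y ^ 2 * (2 ^ (ε / 3) * (X ^ 2) ^ (ε / 3) * Y ^ ε)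
      = (2 ^ (ε / 3) * Y ^ 2 * Y ^ ε * X ^ 2) * (X ^ 2) ^ (ε / 3) := by ring
    _ ≤ (2 ^ (ε / 3) * Y ^ 2 * Y ^ ε * X ^ 2) * X ^ ε := mul_le_mul_of_nonneg_left e2 this
    _ = 2 ^ (ε / 3) * (X ^ 2 * X ^ ε) * (Y ^ 2 * Y ^ ε) := by ring

/-- **The monochromatic count is `≪_ε X^{2+ε} Y^{2+ε}`**: `K(X, Y) ≤ 12 #P² T²` with
`T = C_δ (2X²Y³)^δ`, `δ = ε/6` (diagonal slices `≤ 2#P`, at most `4#P·T` of them; off-diagonal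
slices `≤ 4T²`), as in the proof of `fourthMoment_le_three`. [folklore] -/
theorem monoCount_le :
    ∀ ε : ℝ, 0 < ε → ∃ C : ℝ, 0 < C ∧ ∀ X Y : ℕ, 1 ≤ X → 1 ≤ Y →
      (monoCount X Y : ℝ) ≤ C * (X : ℝ) ^ (2 + ε) * (Y : ℝ) ^ (2 + ε) := by
  intro ε hε
  obtain ⟨Cd, hCd1, hCd⟩ :=
    Literature.NumberTheory.Sieve.exists_card_divisors_le_mul_rpow (ε := ε / 6) (by positivity)
  refine ⟨972 * Cd ^ 2 * (2 : ℝ) ^ (ε / 3), by positivity, fun X Y hX hY => ?_⟩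
  have hX1 : (1 : ℝ) ≤ X := by exact_mod_cast hX
  have hY1 : (1 : ℝ) ≤ Y := by exact_mod_cast hY
  set P := pts X Y with hP_def
  set B : ℝ := 2 * (X : ℝ) ^ 2 * (Y : ℝ) ^ 3 with hB_def
  have hXY1 : (1 : ℝ) ≤ (X : ℝ) ^ 2 * (Y : ℝ) ^ 3 := one_le_mul_of_one_le_of_one_le
    (one_le_pow₀ hX1) (one_le_pow₀ hY1)
  have hB1 : (1 : ℝ) ≤ B := by rw [hB_def]; nlinarith
  set TB : ℝ := Cd * B ^ (ε / 6) with hTB_def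
  have hTB1 : 1 ≤ TB :=
    one_le_mul_of_one_le_of_one_le hCd1 (Real.one_le_rpow hB1 (by positivity))
  have htau : ∀ m : ℤ, m ≠ 0 → |(m : ℝ)| ≤ B → (tau m : ℝ) ≤ TB := fun m hm hmB =>
    tau_le_of_abs_le (by positivity) (by linarith) hCd hm hmB
  have hvalB : ∀ p ∈ P, |((val p : ℤ) : ℝ)| ≤ (X : ℝ) ^ 2 * (Y : ℝ) ^ 3 := fun p hp => by
    have h := abs_val_le hp
    have h' : ((|val p| : ℤ) : ℝ) ≤ (((X : ℤ) ^ 2 * (Y : ℤ) ^ 3 : ℤ) : ℝ) := by exact_mod_cast h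
    push_cast at h'
    exact h'
  have hmB : ∀ t ∈ P ×ˢ P, |((val t.1 - val t.2 : ℤ) : ℝ)| ≤ B := fun t ht => by
    obtain ⟨h1, h2⟩ := mem_product.1 ht
    push_cast
    calc |((val t.1 : ℤ) : ℝ) - val t.2| ≤ |((val t.1 : ℤ) : ℝ)| + |((val t.2 : ℤ) : ℝ)| :=
          abs_sub _ _
      _ ≤ (X : ℝ) ^ 2 * (Y : ℝ) ^ 3 + (X : ℝ) ^ 2 * (Y : ℝ) ^ 3 :=
          add_le_add (hvalB _ h1) (hvalB _ h2)
      _ = B := by rw [hB_def]; ring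
  have hslice : ∀ t ∈ P ×ˢ P, (sliceCount X Y t : ℝ) ≤
      2 * #P * (if val t.1 = val t.2 then 1 else 0) + 4 * TB ^ 2 := by
    intro t ht
    split_ifs with h
    · have h1 : (sliceCount X Y t : ℝ) ≤ 2 * #P := by exact_mod_cast sliceCount_le_of_eq h
      nlinarith
    · have h1 : (sliceCount X Y t : ℝ) ≤
          2 * tau (val t.1 - val t.2) * (2 * tau (val t.1 - val t.2)) := by
        exact_mod_cast sliceCount_le_of_ne h
      have h2 := htau _ (sub_ne_zero.2 h) (hmB t ht)
      have h3 : (0 : ℝ) ≤ tau (val t.1 - val t.2) := Nat.cast_nonneg _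
      nlinarith
  have hsum : (monoCount X Y : ℝ) ≤
      2 * #P * #{t ∈ P ×ˢ P | val t.1 = val t.2} + #(P ×ˢ P) * (4 * TB ^ 2) := by
    rw [monoCount_eq_sum, Nat.cast_sum]
    calc _ ≤ ∑ t ∈ P ×ˢ P, (2 * #P * (if val t.1 = val t.2 then 1 else 0) + 4 * TB ^ 2) :=
          sum_le_sum hslice
      _ = _ := by
          rw [sum_add_distrib, ← mul_sum, sum_boole, sum_const, nsmul_eq_mul]
  have hdiag : (#{t ∈ P ×ˢ P | val t.1 = val t.2} : ℝ) ≤ #P * (4 * TB) := by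
    calc _ ≤ ((∑ p' ∈ P, 4 * tau (val p') : ℕ) : ℝ) := by
          exact_mod_cast card_filter_val_eq_val_le X Y
      _ = ∑ p' ∈ P, 4 * (tau (val p') : ℝ) := by push_cast; rfl
      _ ≤ ∑ p' ∈ P, 4 * TB := sum_le_sum fun p' hp' => by
          have := htau (val p') (val_ne_zero hp')
            ((hvalB p' hp').trans (by rw [hB_def]; nlinarith))
          linarith
      _ = #P * (4 * TB) := by rw [sum_const, nsmul_eq_mul]
  have hPP : (#(P ×ˢ P) : ℝ) = #P * #P := by rw [card_product]; push_cast; ring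
  have hP0 : (0 : ℝ) ≤ #P := Nat.cast_nonneg _
  have hmono : (monoCount X Y : ℝ) ≤ 12 * (#P : ℝ) ^ 2 * TB ^ 2 := by
    have hTB2 : TB ≤ TB ^ 2 := by nlinarith
    calc (monoCount X Y : ℝ) ≤ 2 * #P * (#P * (4 * TB)) + #P * #P * (4 * TB ^ 2) := by
          rw [← hPP]
          exact hsum.trans (by nlinarith [hdiag, hP0])
      _ = 8 * (#P : ℝ) ^ 2 * TB + 4 * (#P : ℝ) ^ 2 * TB ^ 2 := by ring
      _ ≤ 8 * (#P : ℝ) ^ 2 * TB ^ 2 + 4 * (#P : ℝ) ^ 2 * TB ^ 2 := by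
          nlinarith [sq_nonneg (#P : ℝ)]
      _ = 12 * (#P : ℝ) ^ 2 * TB ^ 2 := by ring
  have hPle : (#P : ℝ) ≤ 9 * X * Y := card_pts_le hX hY
  have hTB2 : TB ^ 2 = Cd ^ 2 * B ^ (ε / 3) := by
    rw [hTB_def, mul_pow, ← Real.rpow_two (B ^ (ε / 6)), ← Real.rpow_mul (by linarith)]
    congr 2
    ring
  have hfin := sq_sq_mul_rpow_le hX1 hY1 hε
  calc (monoCount X Y : ℝ) ≤ 12 * (#P : ℝ) ^ 2 * TB ^ 2 := hmono
    _ ≤ 12 * (9 * X * Y) ^ 2 * TB ^ 2 := by gcongr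
    _ = 972 * Cd ^ 2 * ((X : ℝ) ^ 2 * (Y : ℝ) ^ 2 * (2 * (X : ℝ) ^ 2 * (Y : ℝ) ^ 3) ^ (ε / 3)) := by
        rw [hTB2, hB_def]; ring
    _ ≤ 972 * Cd ^ 2 * ((2 : ℝ) ^ (ε / 3) * (X : ℝ) ^ (2 + ε) * (Y : ℝ) ^ (2 + ε)) :=
        mul_le_mul_of_nonneg_left hfin (by positivity)
    _ = 972 * Cd ^ 2 * (2 : ℝ) ^ (ε / 3) * (X : ℝ) ^ (2 + ε) * (Y : ℝ) ^ (2 + ε) := by ring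

/-- **Reduction of the fourth-moment bound to the generic count**: for every `ε > 0` there is
`C = C(ε) > 0` with `N(X, Y) ≤ N_gen(X, Y) + C X^{2+ε} Y^{2+ε}` for all `X, Y ≥ 1`. In particular
Shute's fourth-moment claim `N(X, Y) ≪_ε X^{2+ε}Y^{8/3+ε}` (equivalently Prop. 3.2) holds iff
it holds for the generic count. [folklore] -/
theorem fourthMoment_le_genericMoment_add :
    ∀ ε : ℝ, 0 < ε → ∃ C : ℝ, 0 < C ∧ ∀ X Y : ℕ, 1 ≤ X → 1 ≤ Y →
      (fourthMoment X Y : ℝ) ≤ genericMoment X Y + C * (X : ℝ) ^ (2 + ε) * (Y : ℝ) ^ (2 + ε) := by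
  intro ε hε
  obtain ⟨C, hC, hK⟩ := monoCount_le ε hε
  refine ⟨12 * C, by positivity, fun X Y hX hY => ?_⟩
  have h : (fourthMoment X Y : ℝ) ≤ genericMoment X Y + 12 * monoCount X Y := by
    exact_mod_cast fourthMoment_le_genericMoment_add_mul_monoCount X Y
  have := hK X Y hX hY
  linarith

/-- **Criterion for Prop. 3.2**: if the generic count satisfies
`N_gen(X, Y) ≤ C_ε X^{2+ε} Y^{8/3+ε}` for all `X, Y ≥ 1`, then `Shute2021_prop32` holds
(via `fourthMoment_le_genericMoment_add` and Hölder, `Shute2021_prop32_of_fourthMoment_le`).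
[folklore] -/
theorem Shute2021_prop32_of_genericMoment_le
    (h : ∀ ε : ℝ, 0 < ε → ∃ C : ℝ, ∀ X Y : ℕ, 1 ≤ X → 1 ≤ Y →
      (genericMoment X Y : ℝ) ≤ C * (X : ℝ) ^ (2 + ε) * (Y : ℝ) ^ (8 / 3 + ε)) :
    Shute2021_prop32 := by
  refine Shute2021_prop32_of_fourthMoment_le fun ε hε => ?_
  obtain ⟨C₁, h₁⟩ := h ε hε
  obtain ⟨C₂, hC₂, h₂⟩ := fourthMoment_le_genericMoment_add ε hε
  refine ⟨max C₁ 0 + C₂, by positivity, fun X Y hX hY => ?_⟩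
  have hX1 : (1 : ℝ) ≤ X := by exact_mod_cast hX
  have hY1 : (1 : ℝ) ≤ Y := by exact_mod_cast hY
  have hXp : (0 : ℝ) ≤ (X : ℝ) ^ (2 + ε) := by positivity
  have hY23 : (Y : ℝ) ^ (2 + ε) ≤ (Y : ℝ) ^ (8 / 3 + ε) :=
    Real.rpow_le_rpow_of_exponent_le hY1 (by norm_num)
  have hY0 : (0 : ℝ) ≤ (Y : ℝ) ^ (8 / 3 + ε) := by positivity
  have hg := h₁ X Y hX hY
  have hN := h₂ X Y hX hY
  have hC1 : C₁ * (X : ℝ) ^ (2 + ε) * (Y : ℝ) ^ (8 / 3 + ε) ≤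
      max C₁ 0 * (X : ℝ) ^ (2 + ε) * (Y : ℝ) ^ (8 / 3 + ε) := by
    gcongr
    exact le_max_left _ _
  have hC2 : C₂ * (X : ℝ) ^ (2 + ε) * (Y : ℝ) ^ (2 + ε) ≤
      C₂ * (X : ℝ) ^ (2 + ε) * (Y : ℝ) ^ (8 / 3 + ε) :=
    mul_le_mul_of_nonneg_left hY23 (by positivity)
  calc (fourthMoment X Y : ℝ) ≤ genericMoment X Y + C₂ * (X : ℝ) ^ (2 + ε) * (Y : ℝ) ^ (2 + ε) := hN
    _ ≤ max C₁ 0 * (X : ℝ) ^ (2 + ε) * (Y : ℝ) ^ (8 / 3 + ε) +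
        C₂ * (X : ℝ) ^ (2 + ε) * (Y : ℝ) ^ (8 / 3 + ε) := add_le_add (hg.trans hC1) hC2
    _ = (max C₁ 0 + C₂) * (X : ℝ) ^ (2 + ε) * (Y : ℝ) ^ (8 / 3 + ε) := by ring

/-- **Additive energy of the squareful shape vs. the generic count** (the form consumed by route
`ABC/ExceptionalSetEnergy`): for `S = S(X, Y) = {x²y³ : 1 ≤ x ≤ X, 1 ≤ y ≤ Y, y square-free}`
(`Shute2021.squarefulShape`), `E[S, S] ≤ N_gen(X, Y) + C_ε (XY)^ε X² Y²`. [folklore] -/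
theorem addEnergy_squarefulShape_le_genericMoment_add :
    ∀ ε : ℝ, 0 < ε → ∃ C : ℝ, 0 < C ∧ ∀ X Y : ℕ, 1 ≤ X → 1 ≤ Y →
      (Finset.addEnergy (squarefulShape X Y) (squarefulShape X Y) : ℝ) ≤
        genericMoment X Y + C * ((X : ℝ) * Y) ^ ε * (X : ℝ) ^ 2 * (Y : ℝ) ^ 2 := by
  intro ε hε
  obtain ⟨C, hC, hN⟩ := fourthMoment_le_genericMoment_add ε hε
  refine ⟨C, hC, fun X Y hX hY => ?_⟩
  have hX0 : (0 : ℝ) < X := by exact_mod_cast hX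
  have hY0 : (0 : ℝ) < Y := by exact_mod_cast hY
  calc (Finset.addEnergy (squarefulShape X Y) (squarefulShape X Y) : ℝ)
      ≤ fourthMoment X Y := by exact_mod_cast addEnergy_squarefulShape_le_fourthMoment X Y
    _ ≤ genericMoment X Y + C * (X : ℝ) ^ (2 + ε) * (Y : ℝ) ^ (2 + ε) := hN X Y hX hY
    _ = genericMoment X Y + C * ((X : ℝ) * Y) ^ ε * (X : ℝ) ^ 2 * (Y : ℝ) ^ 2 := by
        rw [Real.rpow_add hX0, Real.rpow_add hY0, Real.mul_rpow hX0.le hY0.le, Real.rpow_two,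
          Real.rpow_two]
        ring

/-- **Criterion for the conjectural exponent `2`** (route item `SquarefulShapeEnergy` of
`ABC/ExceptionalSetEnergy`, spelled with the same set `S`): if `N_gen(X, Y) ≤ C_ε (XY)^ε X²Y²` for
all `X, Y ≥ 1`, then `E[S, S] ≤ C'_ε (XY)^ε X² Y²`. [folklore] -/
theorem addEnergy_squarefulShape_le_two_of_genericMoment_le
    (h : ∀ ε : ℝ, 0 < ε → ∃ C : ℝ, ∀ X Y : ℕ, 1 ≤ X → 1 ≤ Y →
      (genericMoment X Y : ℝ) ≤ C * ((X : ℝ) * Y) ^ ε * (X : ℝ) ^ 2 * (Y : ℝ) ^ 2) :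
    ∀ ε : ℝ, 0 < ε → ∃ C : ℝ, 0 < C ∧ ∀ X Y : ℕ, 1 ≤ X → 1 ≤ Y →
      (Finset.addEnergy (squarefulShape X Y) (squarefulShape X Y) : ℝ) ≤
        C * ((X : ℝ) * Y) ^ ε * (X : ℝ) ^ 2 * (Y : ℝ) ^ 2 := by
  intro ε hε
  obtain ⟨C₁, h₁⟩ := h ε hε
  obtain ⟨C₂, hC₂, h₂⟩ := addEnergy_squarefulShape_le_genericMoment_add ε hε
  refine ⟨max C₁ 0 + C₂, by positivity, fun X Y hX hY => ?_⟩
  have hg := h₁ X Y hX hY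
  have hE := h₂ X Y hX hY
  have hM : (0 : ℝ) ≤ ((X : ℝ) * Y) ^ ε * (X : ℝ) ^ 2 * (Y : ℝ) ^ 2 := by positivity
  have hC1 : C₁ * ((X : ℝ) * Y) ^ ε * (X : ℝ) ^ 2 * (Y : ℝ) ^ 2 ≤
      max C₁ 0 * ((X : ℝ) * Y) ^ ε * (X : ℝ) ^ 2 * (Y : ℝ) ^ 2 := by
    have := mul_le_mul_of_nonneg_right (le_max_left C₁ 0) hM
    linarith [this]
  calc (Finset.addEnergy (squarefulShape X Y) (squarefulShape X Y) : ℝ)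
      ≤ genericMoment X Y + C₂ * ((X : ℝ) * Y) ^ ε * (X : ℝ) ^ 2 * (Y : ℝ) ^ 2 := hE
    _ ≤ max C₁ 0 * ((X : ℝ) * Y) ^ ε * (X : ℝ) ^ 2 * (Y : ℝ) ^ 2 +
        C₂ * ((X : ℝ) * Y) ^ ε * (X : ℝ) ^ 2 * (Y : ℝ) ^ 2 := by linarith [hg.trans hC1]
    _ = (max C₁ 0 + C₂) * ((X : ℝ) * Y) ^ ε * (X : ℝ) ^ 2 * (Y : ℝ) ^ 2 := by ring

end RealBound

end Shute2021

end Literature.NumberTheory.DiophantineGeometry
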